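import Mathlib
import Literature.NumberTheory.Transcendental.KZCalculusProofs
import Literature.NumberTheory.Transcendental.KZSemiCanonicalReductionProofs
import Literature.NumberTheory.Transcendental.KZSemiCanonicalReductionDimOne
import Summits.KontsevichZagierPeriods.KontsevichZagierPeriods.Theorems.SoloInformedCubeResolution
import HarnessLib
import HarnessLib.Audit

/-!
# SoloInformed — the resolution crux reduces to volumes of bounded semialgebraic sets

The open input `SoloInformedAyoubCubeResolution` of the Ayoub transfer
(`soloInformed_ayoubTransfer₄ : CubeResolution → AyoubKZeffQ → KontsevichZagierPeriods`) asks that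
every integral representation be KZ-equivalent, up to a positive multiple, to an integer
combination of cube integrals of cube germs. This file splits it into a published theorem and a
statement about VOLUMES only:

* `H` = separation of poles over the calculus [Viu-Sos 2021, Cor. 2.2, via Hironaka's embedded
  resolution], in the weak form used as the hypothesis of the tree's
  `KZ.semiCanonicalReduction_of_boundedReduction`: a rational representation on a bounded domain is
  KZ-equivalent to a finite sum of representations with bounded domains and bounded integrands
  (stated verbatim as a hypothesis; it is a theorem in print, not in the tree);
* `SoloInformedVolumeResolution` (conjecture, the remaining crux): every bounded semialgebraic
  VOLUME `[K, 1]` is KZ-equivalent, up to a positive multiple, to an integer combination of cube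
  integrals of cube germs.

`soloInformed_cubeResolution_of_volumes : SoloInformedSeparationOfPoles →
SoloInformedVolumeResolution → SoloInformedAyoubCubeResolution` (`H` registered by name as
`SoloInformedSeparationOfPoles`, needed in dimension `≥ 2` only). Chain, all inside the calculus:
`r ≡ r'` rational in more
variables (`KZ.exists_isRational_equivalent_holds`); `r' ≡ ∑_T R_T` with bounded domains
[Viu-Sos 2021, Thm. 2.1; tree `KZ.exists_sub_sum_bounded_mem_relations`]; `R_T ≡ ∑_j R_{Tj}` with
bounded integrands (`H`); `R_{Tj} ≡ [A, 1] − [B, 1]` with `A, B ⊂ ℝ^{m+1}` bounded [Viu-Sos 2021,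
Cor. 2.3; tree `KZ.exists_sub_of_isBounded`: sign split and region under the graph, a Newton–Leibniz
move]; then volume resolution. The bookkeeping is carried by the set `soloInformedPresentable`
(closed under relations, sums, negation). Finally
`soloInformed_ayoubTransfer₆ : SoloInformedSeparationOfPoles → SoloInformedVolumeResolution →
SoloInformedAyoubKZeffQ → KontsevichZagierPeriods`.

References: J. Viu-Sos, Int. J. Number Theory 17 (2021), Thm. 1.1, Thm. 2.1, Cor. 2.2–2.3;
J. Ayoub, EMS Newsl. 91 (2014), §2.2; Kontsevich–Zagier 2001, §1.2.
-/

noncomputable section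

open scoped BigOperators
open MeasureTheory Set
open Literature.NumberTheory.Transcendental Literature.NumberTheory.Transcendental.KZ

namespace Summit.KontsevichZagierPeriods.KontsevichZagierPeriods.Theorems

/-! ### Presentable formal combinations -/

/-- The set of *presentable* formal combinations of integral representations: those a positive
multiple of which is KZ-equivalent to an integer combination of cube integrals of (real parts of)
cube germs, indexed by an arbitrary finite type. -/
def soloInformedPresentable : Set FormalRep :=
  {x | ∃ (k : ℕ) (_ : k ≠ 0) (ι : Type) (_ : Fintype ι) (d : ι → ℕ)
    (G : ∀ j, SoloInformedCubeGerm (d j)) (c : ι → ℤ) (ρ : ∀ j, IntegralRep (d j)),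
    (∀ j, (ρ j).domain = soloInformedCube (d j)) ∧
    (∀ j, EqOn (ρ j).integrand (fun x => ((G j).g (soloInformedToC (d j) x)).re)
      (soloInformedCube (d j))) ∧
    k • x - ∑ j, c j • of (ρ j) ∈ relations}

/-- Membership in `soloInformedPresentable`, unfolded. -/
theorem soloInformed_mem_presentable_iff {x : FormalRep} : x ∈ soloInformedPresentable ↔
    ∃ (k : ℕ) (_ : k ≠ 0) (ι : Type) (_ : Fintype ι) (d : ι → ℕ)
      (G : ∀ j, SoloInformedCubeGerm (d j)) (c : ι → ℤ) (ρ : ∀ j, IntegralRep (d j)),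
      (∀ j, (ρ j).domain = soloInformedCube (d j)) ∧
      (∀ j, EqOn (ρ j).integrand (fun x => ((G j).g (soloInformedToC (d j) x)).re)
        (soloInformedCube (d j))) ∧
      k • x - ∑ j, c j • of (ρ j) ∈ relations :=
  Iff.rfl

/-- Relations are presentable (empty combination). -/
theorem soloInformed_presentable_of_mem_relations {x : FormalRep} (hx : x ∈ relations) :
    x ∈ soloInformedPresentable :=
  soloInformed_mem_presentable_iff.2 ⟨1, one_ne_zero, Fin 0, inferInstance, Fin.elim0,
    fun j => j.elim0, Fin.elim0, fun j => j.elim0, fun j => j.elim0, fun j => j.elim0,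
    by simpa using hx⟩

/-- Bookkeeping identity for sums of presentable elements. -/
theorem soloInformed_presentable_add_identity {A : Type*} [AddCommGroup A] (k k' : ℕ)
    (x y Sx Sy : A) :
    (k * k') • (x + y) - (k' • Sx + k • Sy) = k' • (k • x - Sx) + k • (k' • y - Sy) := by
  module

/-- A natural multiple of an integer combination is the combination with multiplied
coefficients. -/
theorem soloInformed_nsmul_sum_zsmul {A : Type*} [AddCommGroup A] {ι : Type*} (s : Finset ι)
    (w : ℕ) (c : ι → ℤ) (y : ι → A) :
    w • ∑ j ∈ s, c j • y j = ∑ j ∈ s, ((w : ℤ) * c j) • y j := by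
  rw [Finset.smul_sum]
  exact Finset.sum_congr rfl fun j _ => by rw [← smul_smul, natCast_zsmul]

/-- Presentable elements are closed under addition (multiply the multiplicities, concatenate the
families). -/
theorem soloInformed_presentable_add {x y : FormalRep} (hx : x ∈ soloInformedPresentable)
    (hy : y ∈ soloInformedPresentable) : x + y ∈ soloInformedPresentable := by
  obtain ⟨k, hk, ι, hι, d, G, c, ρ, hd, hI, hrel⟩ := soloInformed_mem_presentable_iff.1 hx
  obtain ⟨k', hk', ι', hι', d', G', c', ρ', hd', hI', hrel'⟩ :=
    soloInformed_mem_presentable_iff.1 hy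
  refine soloInformed_mem_presentable_iff.2
    ⟨k * k', mul_ne_zero hk hk', ι ⊕ ι', inferInstance, Sum.elim d d',
    fun j => match j with | Sum.inl a => G a | Sum.inr b => G' b,
    Sum.elim (fun a => (k' : ℤ) * c a) (fun b => (k : ℤ) * c' b),
    fun j => match j with | Sum.inl a => ρ a | Sum.inr b => ρ' b, ?_, ?_, ?_⟩
  · rintro (a | b)
    exacts [hd a, hd' b]
  · rintro (a | b)
    exacts [hI a, hI' b]
  · rw [Fintype.sum_sum_type]
    simp only [Sum.elim_inl, Sum.elim_inr]
    rw [← soloInformed_nsmul_sum_zsmul, ← soloInformed_nsmul_sum_zsmul,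
      soloInformed_presentable_add_identity]
    exact relations.add_mem (relations.nsmul_mem hrel k') (relations.nsmul_mem hrel' k)

/-- Presentable elements are closed under negation (negate the coefficients). -/
theorem soloInformed_presentable_neg {x : FormalRep} (hx : x ∈ soloInformedPresentable) :
    -x ∈ soloInformedPresentable := by
  obtain ⟨k, hk, ι, hι, d, G, c, ρ, hd, hI, hrel⟩ := soloInformed_mem_presentable_iff.1 hx
  refine soloInformed_mem_presentable_iff.2 ⟨k, hk, ι, hι, d, G, fun j => -c j, ρ, hd, hI, ?_⟩
  have he : k • (-x) - ∑ j, (-c j) • of (ρ j) = -(k • x - ∑ j, c j • of (ρ j)) := by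
    simp only [neg_smul, Finset.sum_neg_distrib, smul_neg]
    abel
  rw [he]
  exact relations.neg_mem hrel

/-- Presentable elements are closed under subtraction. -/
theorem soloInformed_presentable_sub {x y : FormalRep} (hx : x ∈ soloInformedPresentable)
    (hy : y ∈ soloInformedPresentable) : x - y ∈ soloInformedPresentable := by
  rw [sub_eq_add_neg]
  exact soloInformed_presentable_add hx (soloInformed_presentable_neg hy)

/-- Presentability passes along KZ-equivalence. -/
theorem soloInformed_presentable_of_sub_mem {x y : FormalRep} (h : x - y ∈ relations)
    (hy : y ∈ soloInformedPresentable) : x ∈ soloInformedPresentable := by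
  rw [show x = (x - y) + y by abel]
  exact soloInformed_presentable_add (soloInformed_presentable_of_mem_relations h) hy

/-- Finite sums of presentable elements are presentable. -/
theorem soloInformed_presentable_sum {α : Type*} (s : Finset α) (f : α → FormalRep)
    (h : ∀ a ∈ s, f a ∈ soloInformedPresentable) : ∑ a ∈ s, f a ∈ soloInformedPresentable := by
  classical
  induction s using Finset.induction_on with
  | empty => simpa using soloInformed_presentable_of_mem_relations relations.zero_mem
  | insert a s ha ih =>
    rw [Finset.sum_insert ha]
    exact soloInformed_presentable_add (h a (Finset.mem_insert_self a s))
      (ih fun b hb => h b (Finset.mem_insert_of_mem hb))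

/-- A presentable element in the `Fin`-indexed shape of `SoloInformedAyoubCubeResolution`. -/
theorem soloInformed_exists_fin_of_presentable {x : FormalRep} (hx : x ∈ soloInformedPresentable) :
    ∃ (k : ℕ) (_ : k ≠ 0) (m : ℕ) (d : Fin m → ℕ) (G : ∀ j, SoloInformedCubeGerm (d j))
      (c : Fin m → ℤ) (ρ : ∀ j, IntegralRep (d j)),
      (∀ j, (ρ j).domain = soloInformedCube (d j)) ∧
      (∀ j, EqOn (ρ j).integrand (fun x => ((G j).g (soloInformedToC (d j) x)).re)
        (soloInformedCube (d j))) ∧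
      k • x - ∑ j, c j • of (ρ j) ∈ relations := by
  obtain ⟨k, hk, ι, hι, d, G, c, ρ, hd, hI, hrel⟩ := soloInformed_mem_presentable_iff.1 hx
  let e := (Fintype.equivFin ι).symm
  refine ⟨k, hk, Fintype.card ι, fun l => d (e l), fun l => G (e l), fun l => c (e l),
    fun l => ρ (e l), fun l => hd _, fun l => hI _, ?_⟩
  rwa [e.sum_comp (fun j => c j • of (ρ j))]

/-! ### The volume crux -/

/-- **The volume crux.** Every bounded `ℚ`-semialgebraic volume `[K, 1]` is KZ-equivalent, up to a
positive multiple, to an integer combination of cube integrals of real parts of cube germs. Open: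
resolution of singularities inside the KZ calculus (cylindrical decomposition, Nash charts,
blow-ups and ramified substitutions — rectilinearisation of bounded Nash functions).
[Ayoub 2014, §2.2; Viu-Sos 2021, §2.3; Kontsevich–Zagier 2001, §1.2] -/
@[conjecture] def SoloInformedVolumeResolution : Prop :=
  ∀ (m : ℕ) (V : IntegralRep m), Bornology.IsBounded V.domain →
    (∀ x ∈ V.domain, V.integrand x = 1) →
    ∃ (k : ℕ) (_ : k ≠ 0) (M : ℕ) (d : Fin M → ℕ) (G : ∀ j, SoloInformedCubeGerm (d j))
      (c : Fin M → ℤ) (ρ : ∀ j, IntegralRep (d j)),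
      (∀ j, (ρ j).domain = soloInformedCube (d j)) ∧
      (∀ j, EqOn (ρ j).integrand (fun x => ((G j).g (soloInformedToC (d j) x)).re)
        (soloInformedCube (d j))) ∧
      k • of V - ∑ j, c j • of (ρ j) ∈ relations

/-- Bounded volumes are presentable under the volume crux. -/
theorem soloInformed_presentable_of_volume (hV : SoloInformedVolumeResolution) {m : ℕ}
    (V : IntegralRep m) (hb : Bornology.IsBounded V.domain)
    (h1 : ∀ x ∈ V.domain, V.integrand x = 1) : of V ∈ soloInformedPresentable := by
  obtain ⟨k, hk, M, d, G, c, ρ, hd, hI, hrel⟩ := hV m V hb h1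
  exact soloInformed_mem_presentable_iff.2 ⟨k, hk, Fin M, inferInstance, d, G, c, ρ, hd, hI, hrel⟩

/-- **Every integral representation is presentable, given separation of poles and the volume
crux.** [Viu-Sos 2021, Thm. 2.1, Cor. 2.2 (hypothesis), Cor. 2.3] -/
theorem soloInformed_presentable_of_volumes
    (H : ∀ ⦃n : ℕ⦄ (r : IntegralRep n), r.IsRational → Bornology.IsBounded r.domain →
      ∃ (k : ℕ) (R : Fin k → IntegralRep n), (∀ j, Bornology.IsBounded (R j).domain ∧
        ∃ M : ℝ, ∀ x ∈ (R j).domain, |(R j).integrand x| ≤ M) ∧ of r - ∑ j, of (R j) ∈ relations)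
    (hV : SoloInformedVolumeResolution) {n : ℕ} (r : IntegralRep n) :
    of r ∈ soloInformedPresentable := by
  -- rational shape in more variables
  obtain ⟨m, r', hr', hrr'⟩ := exists_isRational_equivalent_holds r
  refine soloInformed_presentable_of_sub_mem hrr' ?_
  -- bounded domains
  obtain ⟨R, hR, hrel⟩ := exists_sub_sum_bounded_mem_relations r' hr'
  refine soloInformed_presentable_of_sub_mem hrel (soloInformed_presentable_sum _ _ fun T _ => ?_)
  -- bounded integrands (separation of poles)
  obtain ⟨K, P, hP, hrelP⟩ := H (R T) (hR T).1 (hR T).2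
  refine soloInformed_presentable_of_sub_mem hrelP (soloInformed_presentable_sum _ _ fun j _ => ?_)
  -- volumes
  obtain ⟨hb, M, hM⟩ := hP j
  obtain ⟨A, B, hA, hB, hA1, hB1, hAB⟩ := exists_sub_of_isBounded (P j) hb hM
  exact soloInformed_presentable_of_sub_mem hAB
    (soloInformed_presentable_sub (soloInformed_presentable_of_volume hV A hA hA1)
      (soloInformed_presentable_of_volume hV B hB hB1))

/-! ### Separation of poles as a named obligation -/

/-- **Separation of poles in dimension `≥ 2`** (the bounded reduction): every rational integral
representation on a bounded domain in `ℝⁿ`, `n ≥ 2`, is KZ-equivalent to a finite sum of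
representations with bounded domains and bounded integrands. A THEOREM in print — [Viu-Sos 2021,
Cor. 2.2] (for `n = 2` the explicit blow-up algorithm of §3, for `n ≥ 3` Hironaka's embedded
resolution of singularities) — not yet formalised; it is the hypothesis `H` of the tree's
`KZ.semiCanonicalReduction_of_boundedReduction_two_le`, registered here by name so that it can be
discharged by name. Dimensions `0` and `1` are theorems of the tree (`KZ.boundedReduction_zero`,
`KZ.boundedReduction_one`). -/
@[conjecture] def SoloInformedSeparationOfPoles : Prop :=
  ∀ ⦃n : ℕ⦄, 2 ≤ n → ∀ r : IntegralRep n, r.IsRational → Bornology.IsBounded r.domain →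
    ∃ (k : ℕ) (R : Fin k → IntegralRep n), (∀ j, Bornology.IsBounded (R j).domain ∧
      ∃ M : ℝ, ∀ x ∈ (R j).domain, |(R j).integrand x| ≤ M) ∧ of r - ∑ j, of (R j) ∈ relations

/-- Separation of poles in all dimensions from dimension `≥ 2` (dimensions `0`, `1` are in the
tree: no integrable poles in one variable). [Viu-Sos 2021, §2.3, Cor. 2.2] -/
theorem soloInformed_boundedReduction_of_two_le (H₂ : SoloInformedSeparationOfPoles)
    ⦃n : ℕ⦄ (r : IntegralRep n) (hr : r.IsRational) (hb : Bornology.IsBounded r.domain) :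
    ∃ (k : ℕ) (R : Fin k → IntegralRep n), (∀ j, Bornology.IsBounded (R j).domain ∧
      ∃ M : ℝ, ∀ x ∈ (R j).domain, |(R j).integrand x| ≤ M) ∧ of r - ∑ j, of (R j) ∈ relations := by
  rcases Nat.lt_or_ge n 2 with hn | hn
  · interval_cases n
    · exact boundedReduction_zero r hr hb
    · exact boundedReduction_one r hr hb
  · exact H₂ hn r hr hb

/-- **Separation of poles and the volume crux imply the resolution statement.**
[Viu-Sos 2021, Cor. 2.2; Kontsevich–Zagier 2001, §1.2] -/
theorem soloInformed_cubeResolution_of_volumes (H₂ : SoloInformedSeparationOfPoles)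
    (hV : SoloInformedVolumeResolution) : SoloInformedAyoubCubeResolution :=
  fun _ r => soloInformed_exists_fin_of_presentable
    (soloInformed_presentable_of_volumes (soloInformed_boundedReduction_of_two_le H₂) hV r)

/-- Conversely the resolution statement contains the volume crux (restriction). -/
theorem soloInformed_volumeResolution_of_cubeResolution (h : SoloInformedAyoubCubeResolution) :
    SoloInformedVolumeResolution :=
  fun m V _ _ => h m V

/-- **The Ayoub transfer from volumes**: separation of poles in dimension `≥ 2` [Viu-Sos 2021,
Cor. 2.2], the volume crux and Ayoub's conjecture up to torsion [Ayoub 2014, §2.2, Conj. 7,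
Prop. 11, Rem. 13] imply the Kontsevich–Zagier period conjecture. -/
theorem soloInformed_ayoubTransfer₆ (H₂ : SoloInformedSeparationOfPoles)
    (hV : SoloInformedVolumeResolution) (hA : SoloInformedAyoubKZeffQ) : KontsevichZagierPeriods :=
  soloInformed_ayoubTransfer₄ (soloInformed_cubeResolution_of_volumes H₂ hV) hA

end Summit.KontsevichZagierPeriods.KontsevichZagierPeriods.Theorems
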